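import Summits.AtomisticToContinuum.BoseEinsteinCondensation.Theses.BECPalmDirectCorrelation

/-!
# Route `BECPalmDirectCorrelation`, assembly item `Assembly` (stmt-AtomisticToContinuum-13879)

Settles the assembly item `stmt-AtomisticToContinuum-13879` of route
`route-AtomisticToContinuum-BECPalmDirectCorrelation`: the implication

  `NonlinearPalmBound → GaussianPalmBound → PalmSplitGlue → PalmChiSqCondensation →
    BoundaryTransferWeak → BoseEinsteinCondensation`

(the audited sub-problem abbrev `_root_.BoseEinsteinCondensation`, by name).

The hypotheses of `Assembly` are exactly those of the route's deciding theorem `closes`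
(in the order ranks 2, 3, 9, 4, 5), so the assembly is that composition, spelled out here so that
this file depends only on the item statements: fix a repulsive finite-range `v`;
`NonlinearPalmBound` and `GaussianPalmBound` give their bodies for `v`; the glue `PalmSplitGlue`
turns them into the liminf χ² bound for `v`; `PalmChiSqCondensation` turns that into the
`PeriodicBEC` body for `v`; `BoundaryTransferWeak` gives `∃ ρ₀ > 0, ∀ ρ ∈ (0, ρ₀),
HasGroundStateBEC v ρ`, i.e. the conjunct `BoseEinsteinCondensation` at `v`.
Pure logic; no analytic content lives here.

References: [LSSY2005, §1.2 and Ch. 5] (the conjunct being assembled), [PenroseOnsager1956]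
(the one-mode occupation criterion behind the `PeriodicBEC` body).
-/

namespace Summit.AtomisticToContinuum.BoseEinsteinCondensation.Theorems

/-- **Item stmt-AtomisticToContinuum-13879** (`Assembly` of route `BECPalmDirectCorrelation`, exact
route decl): given `h2 : NonlinearPalmBound`, `h3 : GaussianPalmBound`, the glue
`h9 : PalmSplitGlue`, the criterion `h4 : PalmChiSqCondensation` and the transfer
`h5 : BoundaryTransferWeak`, for every repulsive finite-range `v` the term
`h5 v hv (h4 v hv (h9 v hv (h2 v hv) (h3 v hv)))` is `∃ ρ₀ > 0, ∀ ρ ∈ (0, ρ₀), HasGroundStateBEC v ρ`,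
which is `BoseEinsteinCondensation` at `v`. Pure composition of the route's hypotheses (the route's
deciding theorem `closes`, with its hypotheses in the item's order). [folklore] -/
theorem becPalmDirectCorrelation_assembly_proof :
    Summit.AtomisticToContinuum.BoseEinsteinCondensation.Theses.BECPalmDirectCorrelation.Assembly := by
  unfold Theses.BECPalmDirectCorrelation.Assembly
  intro h2 h3 h9 h4 h5
  exact fun v hv => h5 v hv (h4 v hv (h9 v hv (h2 v hv) (h3 v hv)))

end Summit.AtomisticToContinuum.BoseEinsteinCondensation.Theorems
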